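import Summits.CriticalPhenomena.SAWScalingLimit.Theorems.SAWLoopFugacityFlowAvoidanceLimitSphereRatioLimitContinuum

/-!
# `stub_sphereRatioLimit` reduced to ONE lattice input: the killed-SRW Green's-function ratio
# invariance principle on the two exit spheres
— helper file 2 of stub `stub_sphereRatioLimit` (S3b) of line `symplectic-fermion-anchor`
(crux `SAWLoopFugacityFlow.AvoidanceLimit`, stmt-CriticalPhenomena-10649)

The stub `stub_sphereRatioLimit` (lead c1 reshape S3b of `stub_excursionRatio`): for hull data
`(D, D', φ, A, Φ, d)` and every `η > 0` there is `r₀ > 0` such that for every radius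
`r ∈ (0, r₀)`, for all small mesh `δ`, at every pair `(z, y)` of the two lattice exit spheres
`r ≤ |δz − a| < r + δ`, `r ≤ |δy − b| < r + δ` with `G_δ(z,y) > 0`, the killed-SRW ratio
`F_δ(z,y) = G^c_δ(z,y)/G_δ(z,y)` ("walk confined to `closure D'`" over "walk in `Ω_δ`",
`greenEntry` of `confinedGraph` over `greenEntry` of `discreteDomainGraph`, common volume
`meshDomainFinset D δ`) is within `η` of `d = Φ'_A(0)`.

Its two halves:

* (i) CONTINUUM — LANDED in helper file 1 (`greenRatioCont_near_pts`,
  `…SphereRatioLimitContinuum`): the ratio of continuum Green's functions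
  `ρ(z,y) = G_{ℍ∖A}(φ⁻¹z, φ⁻¹y)/G_ℍ(φ⁻¹z, φ⁻¹y) = G_{D'}(z,y)/G_D(z,y)` is within `η` of `d` for all
  `z, y ∈ D` with `|z − a|, |y − b| < r₀(η)` (Jordan `D`: Carathéodory; no fjord exception);
* (ii) LATTICE — the hypothesis of the reduction below, NOT in the tree: for every fixed small
  radius `r` (below a geometric threshold `r₁` depending on the hull data only) the lattice ratio
  is asymptotic to the continuum one UNIFORMLY over the two lattice spheres,
  `sup {|F_δ(z,y) − ρ(δz, δy)| : z, y on the spheres, G_δ(z,y) > 0} → 0` as `δ → 0+` —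
  an invariance principle for RATIOS of killed simple-random-walk Green's functions in the
  lattice approximation of a Jordan domain, uniform up to the part of `∂D` met by the spheres.

`stub_sphereRatioLimit_of_latticeRatioInvariance` (registered reduction): (ii) ⇒ the stub,
by (i) and the triangle inequality (`r₀ = min r₁ (r₀ⁱ(η/2)/2)`, `δ < r₀ⁱ(η/2)/2` eventually; the
guard `G_δ(z,y) > 0` puts `z, y` in the volume, so `δz, δy ∈ D`).

## Where (ii) stands in print (located by the worker of this stub; none of it is in the tree)

(ii) is the conjunction of three published facts about simple random walk in simply connected
discrete domains `Ω^δ ⊂ δℤ²`, all UNIFORM in the shape of the domain: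

* the uniform discrete BOUNDARY HARNACK principle — D. Chelkak, Y. Wan, Electron. J. Probab. 26
  (2021), arXiv:1903.08045, §3.2, Lemma 3.7 and Corollary 3.8: for positive discrete harmonic
  `H₁, H₂` on `Ω^δ` with Dirichlet conditions on `∂Ω^δ ∖ ∂Ω^δ_o(b, r)`,
  `max_{u,v ∈ Ω^δ ∖ Ω^δ_o(b, 2^{-q}r)} (H₁(u)/H₂(u))/(H₁(v)/H₂(v)) ≤ (1 + k^q)/(1 − k^q)` with a
  universal `k < 1` (applied at `a` and at `b` to `H₁ = G^c_δ(·, y)`, `H₂ = G_δ(·, y)`, which are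
  harmonic for the SAME walk inside the agreement balls `B(a, ε)`, `B(b, ε)` —
  `confinedGraph_adj_iff_of_ball` — this moves both legs from the spheres to fixed interior
  reference points at cost `O(k^q)`, `r ≍ 2^{-q} ε`);
* interior convergence of the discrete Green's function under Carathéodory approximation —
  ibid. Proposition 3.2 / Corollary 3.3 (from D. Chelkak, S. Smirnov, Adv. Math. 228 (2011),
  Thm. 3.10-type): `Z_{Ω^δ}(u^δ, v^δ) → G_Ω(u, v)` uniformly for `u, v` jointly `r`-inside
  (applied to `Ω_δ → D` and to the confined walk `→ D'` at the two reference points);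
* (the continuum identification `G_{D'}/G_D = ρ`, conformal invariance — in the tree's reach).

Convention gap to be bridged by whoever vendors these: the tree's `discreteDomainGraph` /
`confinedGraph` kill the walk on EDGES whose segment leaves the closure (Chelkak's general
discrete domains `(V^Ω, E^Ω_int)` with boundary half-edges, "Robust discrete complex analysis:
a toolbox", Ann. Probab. 44 (2016) §2.2, cover this; the printed statements are for induced
subgraphs). The earlier grid-domain form of the two-boundary-point factorisation is
M. Kozdron, G. Lawler, Electron. J. Probab. 10 (2005), Thm. 1.1 / Prop. 3.10 (named facts
`KozdronLawler_excursionPoissonKernel`, `KozdronLawler_greenFunctionBoundary` of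
`Literature/Probability/LatticeModels/ExcursionPoissonKernelAsymptotics.lean`, vertex-killed,
union-of-squares comparison domain — not directly the tree's `Ω_δ`).

Sources: [ChelkakWan2021] Lemma 3.7, Cor. 3.8, Cor. 3.3, Cor. 3.6; [Chelkak2016] §2.2;
[ChelkakSmirnov2011]; [KozdronLawler2005] Thm. 1.1; [LawlerSchrammWerner2003Restriction]
Prop. 4.1. No definitions.
-/

noncomputable section

open scoped BigOperators Topology symmDiff
open Filter Finset
open Literature.Probability.RandomPlanarGeometry Literature.Probability.LatticeModels

namespace Summit.CriticalPhenomena.SAWScalingLimit.Theorems.AvoidanceLimit.Anchor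

/-- A positive Green's-function entry has both its legs in the volume (the junk value off the
volume is `0`, `greenEntry_of_not`). [folklore] -/
theorem mem_of_greenEntry_pos {H : SimpleGraph (Site 2)} {Λ : Finset (Site 2)} {a b : Site 2}
    (h : 0 < greenEntry H Λ a b) : a ∈ Λ ∧ b ∈ Λ := by
  by_contra hab
  rw [greenEntry_of_not H hab] at h
  exact lt_irrefl _ h

/-- A vertex of the volume `meshDomainFinset Ω δ` (bounded `Ω`, `δ > 0`) has its mesh point in
`Ω` (`meshDomain ⊆ meshVertices`). [folklore] -/
theorem meshPoint_mem_of_mem_meshDomainFinset {Ω : Set ℂ} {δ : ℝ} (hΩ : Bornology.IsBounded Ω)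
    (hδ : 0 < δ) {v : Site 2} (hv : v ∈ meshDomainFinset Ω δ) : meshPoint δ v ∈ Ω := by
  have hv' : v ∈ meshDomain Ω δ := by
    rw [← Finset.mem_coe, coe_meshDomainFinset hΩ hδ] at hv
    exact hv
  exact meshDomain_subset_meshVertices _ _ hv'

/-- **REDUCTION (registered sub-goal): `stub_sphereRatioLimit` follows from the killed-SRW
Green's-function-ratio invariance principle on the two exit spheres.** The hypothesis is the ONE
lattice → continuum input (ii) missing from the tree, stated with the continuum ratio
`ρ(z,y) = log(|Φφ⁻¹z − conj Φφ⁻¹y|/|Φφ⁻¹z − Φφ⁻¹y|)/log(|φ⁻¹z − conj φ⁻¹y|/|φ⁻¹z − φ⁻¹y|)`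
(`= G_{D'}(z,y)/G_D(z,y)`) inline: for hull data `(D, D', φ, A, Φ)` there is a threshold
`r₁ > 0` such that for every radius `r ∈ (0, r₁)` and every `η > 0`, for all small `δ > 0`, at
every pair `(z, y)` of the lattice exit spheres `r ≤ |δz − a| < r + δ`, `r ≤ |δy − b| < r + δ`
with `G_δ(z,y) > 0`, `|G^c_δ(z,y)/G_δ(z,y) − ρ(δz, δy)| ≤ η` — uniform discrete boundary
Harnack principle (Chelkak–Wan 2021, Lemma 3.7 / Cor. 3.8) at `a` and `b` plus interior
convergence of discrete Green's functions (ibid. Cor. 3.3, Chelkak–Smirnov 2011). Given it, the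
stub is the landed continuum half `greenRatioCont_near_pts` (helper file 1) and the triangle
inequality: `r₀ = min r₁ (r₀ⁱ/2)` with `r₀ⁱ = r₀ⁱ(η/2)` from (i), and `δ < r₀ⁱ/2` eventually, so
that the sphere points — which lie in the volume by the guard `G_δ(z,y) > 0`, hence in `D` — are
within `r₀ⁱ` of the marked points. [cite: ChelkakWan2021, Lemma 3.7 and Corollary 3.8 (§3.2)] -/
theorem stub_sphereRatioLimit_of_latticeRatioInvariance :
    (∀ (D D' : DobrushinDomain), D'.carrier ⊆ D.carrier → D'.pt 0 = D.pt 0 → D'.pt 1 = D.pt 1 →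
      (∃ ε : ℝ, 0 < ε ∧ D'.carrier ∩ Metric.ball (D.pt 0) ε = D.carrier ∩ Metric.ball (D.pt 0) ε ∧
        D'.carrier ∩ Metric.ball (D.pt 1) ε = D.carrier ∩ Metric.ball (D.pt 1) ε) →
      ∀ (φ : ConformalEquiv UpperHalfPlane.upperHalfPlaneSet D.carrier), D.IsChordalUniformizing φ →
      ∀ (A : Set ℂ), A = closure (UpperHalfPlane.upperHalfPlaneSet \
        {z | z ∈ UpperHalfPlane.upperHalfPlaneSet ∧ φ z ∈ D'.carrier}) →
      ∀ (Φ : ConformalEquiv (UpperHalfPlane.upperHalfPlaneSet \ A) UpperHalfPlane.upperHalfPlaneSet),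
        IsRestrictionMap A Φ →
      ∃ r₁ : ℝ, 0 < r₁ ∧ ∀ r ∈ Set.Ioo (0 : ℝ) r₁, ∀ η : ℝ, 0 < η → ∀ᶠ δ in 𝓝[>] (0 : ℝ),
        ∀ z y : Site 2, r ≤ dist (meshPoint δ z) (D.pt 0) → dist (meshPoint δ z) (D.pt 0) < r + δ →
          r ≤ dist (meshPoint δ y) (D.pt 1) → dist (meshPoint δ y) (D.pt 1) < r + δ →
          0 < greenEntry (discreteDomainGraph D.carrier δ) (meshDomainFinset D.carrier δ) z y →
          |greenEntry (confinedGraph D.carrier D'.carrier δ) (meshDomainFinset D.carrier δ) z y /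
                greenEntry (discreteDomainGraph D.carrier δ) (meshDomainFinset D.carrier δ) z y -
              Real.log (‖Φ (φ.symm (meshPoint δ z)) - (starRingEnd ℂ) (Φ (φ.symm (meshPoint δ y)))‖ /
                  ‖Φ (φ.symm (meshPoint δ z)) - Φ (φ.symm (meshPoint δ y))‖) /
                Real.log (‖φ.symm (meshPoint δ z) - (starRingEnd ℂ) (φ.symm (meshPoint δ y))‖ /
                  ‖φ.symm (meshPoint δ z) - φ.symm (meshPoint δ y)‖)| ≤ η) →
    ∀ (D D' : DobrushinDomain), D'.carrier ⊆ D.carrier → D'.pt 0 = D.pt 0 → D'.pt 1 = D.pt 1 →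
      (∃ ε : ℝ, 0 < ε ∧ D'.carrier ∩ Metric.ball (D.pt 0) ε = D.carrier ∩ Metric.ball (D.pt 0) ε ∧
        D'.carrier ∩ Metric.ball (D.pt 1) ε = D.carrier ∩ Metric.ball (D.pt 1) ε) →
      ∀ (φ : ConformalEquiv UpperHalfPlane.upperHalfPlaneSet D.carrier), D.IsChordalUniformizing φ →
      ∀ (A : Set ℂ), A = closure (UpperHalfPlane.upperHalfPlaneSet \
        {z | z ∈ UpperHalfPlane.upperHalfPlaneSet ∧ φ z ∈ D'.carrier}) →
      ∀ (Φ : ConformalEquiv (UpperHalfPlane.upperHalfPlaneSet \ A) UpperHalfPlane.upperHalfPlaneSet)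
        (d : ℝ), IsRestrictionMap A Φ → HasRestrictionDeriv A Φ d →
      ∀ η : ℝ, 0 < η → ∃ r₀ : ℝ, 0 < r₀ ∧ ∀ r ∈ Set.Ioo (0 : ℝ) r₀, ∀ᶠ δ in 𝓝[>] (0 : ℝ),
        ∀ z y : Site 2, r ≤ dist (meshPoint δ z) (D.pt 0) → dist (meshPoint δ z) (D.pt 0) < r + δ →
          r ≤ dist (meshPoint δ y) (D.pt 1) → dist (meshPoint δ y) (D.pt 1) < r + δ →
          0 < greenEntry (discreteDomainGraph D.carrier δ) (meshDomainFinset D.carrier δ) z y →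
          |greenEntry (confinedGraph D.carrier D'.carrier δ) (meshDomainFinset D.carrier δ) z y /
              greenEntry (discreteDomainGraph D.carrier δ) (meshDomainFinset D.carrier δ) z y - d| ≤ η := by
  intro hL D D' hsub h0 h1 hball φ hφ A hA Φ d hΦ hd η hη
  obtain ⟨r₁, hr₁, hlat⟩ := hL D D' hsub h0 h1 hball φ hφ A hA Φ hΦ
  obtain ⟨r₂, hr₂, hcont⟩ :=
    greenRatioCont_near_pts D D' hsub h0 h1 hball φ hφ A hA Φ d hΦ hd (η / 2) (by positivity)
  refine ⟨min r₁ (r₂ / 2), lt_min hr₁ (by positivity), fun r hr => ?_⟩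
  have hrr₁ : r ∈ Set.Ioo (0 : ℝ) r₁ := ⟨hr.1, lt_of_lt_of_le hr.2 (min_le_left _ _)⟩
  have hrr₂ : r < r₂ / 2 := lt_of_lt_of_le hr.2 (min_le_right _ _)
  have hδ : ∀ᶠ δ in 𝓝[>] (0 : ℝ), δ ∈ Set.Ioo (0 : ℝ) (r₂ / 2) := Ioo_mem_nhdsGT (by positivity)
  filter_upwards [hlat r hrr₁ (η / 2) (by positivity), hδ] with δ hδL hδr z y hz1 hz2 hy1 hy2 hpos
  -- the guard puts both legs in the volume, hence their mesh points in `D`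
  have hmem := mem_of_greenEntry_pos hpos
  have hzD : meshPoint δ z ∈ D.carrier := meshPoint_mem_of_mem_meshDomainFinset D.isBounded hδr.1 hmem.1
  have hyD : meshPoint δ y ∈ D.carrier := meshPoint_mem_of_mem_meshDomainFinset D.isBounded hδr.1 hmem.2
  -- (i) at the two mesh points, (ii) on the spheres, triangle inequality
  have hc := hcont _ hzD _ hyD (by linarith [hδr.2]) (by linarith [hδr.2])
  have hl := hδL z y hz1 hz2 hy1 hy2 hpos
  have htri := abs_sub_le
    (greenEntry (confinedGraph D.carrier D'.carrier δ) (meshDomainFinset D.carrier δ) z y /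
      greenEntry (discreteDomainGraph D.carrier δ) (meshDomainFinset D.carrier δ) z y)
    (Real.log (‖Φ (φ.symm (meshPoint δ z)) - (starRingEnd ℂ) (Φ (φ.symm (meshPoint δ y)))‖ /
          ‖Φ (φ.symm (meshPoint δ z)) - Φ (φ.symm (meshPoint δ y))‖) /
        Real.log (‖φ.symm (meshPoint δ z) - (starRingEnd ℂ) (φ.symm (meshPoint δ y))‖ /
          ‖φ.symm (meshPoint δ z) - φ.symm (meshPoint δ y)‖)) d
  linarith

end Summit.CriticalPhenomena.SAWScalingLimit.Theorems.AvoidanceLimit.Anchor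

end
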